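import Summits.KontsevichZagierPeriods.KontsevichZagierPeriods.Theorems.RootDecompZetaThreeFrontierWordMatchPreludeP14

/-! # `RootDecompZetaThreeFrontierWordMatchPreludeP15` — part 1/3 of the ≤340-line split of decomp-kz lens-1 g12 `s44_s46_delta.lean`
(sha256 4eadf8a5…; = §44–§46 of `MatchPrelude_v8.lean`: the proof of `…GZLadder.stub_gapClassMatch : GapClassMatch` of «gz_ladder» v4 on
stmt-KontsevichZagierPeriods-32433, proved in part 3/3 = P17).  Sits on the landed WordMatchPrelude P1–P14 (§24–§43).  Mathematics unchanged. -/

set_option linter.dupNamespace false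

noncomputable section

/-! # §44  SHORT-Q LAW: RULES D5 AND D3 IN CLOSED FORM (decomp-kz lens-1 gen 12).  With the short `Q` of NODE.md ADDENDUM 10
(`Q = -(q/g)·g^{κ-e₀}` resp. `(q/b)·g^{κ-e₃}`, homogenised by `SIG = Σ gᵢ` when `κ₀ = 0` resp. `κ₃ = 0`) the D5 / D3 remainders of the
gap-world engine steps `gRc2Q` / `gR1Q` are signed sums of at most six scaled gap classes over the lowered exponent vector; this section
proves the four NUMERATOR identities `aeval g (remainder) = Σ cⱼ · g^{kⱼ}` on `Δ₃°` (uniform in the symbolic exponents: phantom shifts carry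
the factor `κⱼ = 0`). -/

namespace Summit.KontsevichZagierPeriods.RootDecompZetaThreeFrontier.WordLayer

open Set MeasureTheory Literature.NumberTheory.Transcendental MvPolynomial
open Summit.KontsevichZagierPeriods.KontsevichZagierPeriods.Theorems.RootDecompZetaThreeFrontierWordMoves (mem_simplex_three_iff)

section ShortQ

/-- Auxiliary step `gD_gsum` (§44): g D gsum. [bookkeeping] -/
theorem gD_gsum (d : Fin 3) : gD d gsum = 0 := by
  fin_cases d <;> simp [gD, gsum, pderiv_X]

/-- Auxiliary step `gD_two_fC2` (§44): g D two f C2. [bookkeeping] -/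
theorem gD_two_fC2 : gD 2 fC2 = -1 := by
  simp [gD, fC2, pderiv_X]

/-- Auxiliary step `gD_one_fB1` (§44): g D one f B1. [bookkeeping] -/
theorem gD_one_fB1 : gD 1 fB1 = 1 := by
  simp [gD, fB1, pderiv_X]

/-- Auxiliary step `aeval_gaps_fC2` (§44): aeval gaps f C2. [bookkeeping] -/
theorem aeval_gaps_fC2 (t : Fin 3 → ℝ) : aeval (gaps t) fC2 = 1 - t 2 := by
  simp [fC2]

/-- Auxiliary step `aeval_gaps_fAl` (§44): aeval gaps f Al. [bookkeeping] -/
theorem aeval_gaps_fAl (t : Fin 3 → ℝ) : aeval (gaps t) fAl = t 0 - t 2 := by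
  simp [fAl]

/-- Auxiliary step `aeval_gaps_fB1` (§44): aeval gaps f B1. [bookkeeping] -/
theorem aeval_gaps_fB1 (t : Fin 3 → ℝ) : aeval (gaps t) fB1 = t 1 := by
  simp [fB1]

/-- Auxiliary step `aeval_gaps_fC1` (§44): aeval gaps f C1. [bookkeeping] -/
theorem aeval_gaps_fC1 (t : Fin 3 → ℝ) : aeval (gaps t) fC1 = 1 - t 1 := by
  simp [fC1]

/-- coefficient-attached uniform shift: `(e·n) · g^{s+eᵢ-eⱼ} = (e·n) · g^s · gᵢ/gⱼ` whenever `n = sⱼ` (phantom case `n = 0` included) -/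
theorem smul_gmon_gshift {t : Fin 3 → ℝ} (ht : t ∈ KZ.openOrderedSimplex 3) (e : ℚ) (s : Fin 4 →₀ ℕ) (i j : Fin 4) (hij : i ≠ j)
    (n : ℕ) (hn : s j = n) :
    ((e * (n : ℕ) : ℚ) : ℝ) * gmon (gshift s i j) t = ((e * (n : ℕ) : ℚ) : ℝ) * gmon s t * gaps t i / gaps t j := by
  subst hn
  push_cast
  rw [mul_assoc, natCast_mul_gmon_gshift ht s i j hij]
  ring

/-- shift up, coercion-expanded form -/
theorem gmon_coe_add_single (s : Fin 4 →₀ ℕ) (i : Fin 4) (t : Fin 3 → ℝ) :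
    gmon (⇑s + ⇑(Finsupp.single i 1 : Fin 4 →₀ ℕ)) t = gmon s t * gaps t i := by
  rw [← Finsupp.coe_add]
  exact gmon_add_single s i t

/-- from a numerator identity to the class identity -/
theorem layerF_toT_of_numer (R : MvPolynomial (Fin 4) ℚ) {ι : Type*} (T : Finset ι) (cs : ι → ℚ) (ks : ι → (Fin 4 →₀ ℕ))
    (β₀ β₁ γ₁ γ₂ α : ℕ) {t : Fin 3 → ℝ} (h : aeval (gaps t) R = ∑ j ∈ T, (cs j : ℝ) * gmon (ks j) t) :
    layerF (toT R) β₀ β₁ γ₁ γ₂ α t = ∑ j ∈ T, (cs j : ℝ) * gapF (ks j) β₀ β₁ γ₁ γ₂ α t := by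
  rw [layerF_toT_eq, h, Finset.sum_div]
  simp only [gapF_eq_gmon_div, mul_div_assoc]

/-- D5, case `κ₀ ≥ 1` (`κ = κ̃ + e₀`): the six coefficients … -/
noncomputable def d5aC (κt : Fin 4 →₀ ℕ) (q : ℚ) (g a : ℕ) : Fin 6 → ℚ :=
  ![q * ((g : ℚ) + a - 1 - (κt 2 : ℕ)) / g, q / g * (κt 3 : ℕ), q * ((g : ℚ) + a - 1 - 2 * (κt 2 : ℕ)) / g, 2 * q / g * (κt 3 : ℕ),
    -(q / g) * (κt 2 : ℕ), q / g * (κt 3 : ℕ)]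

/-- … and the six exponent vectors `κ̃+e₂, κ̃+2e₂-e₃, κ̃+e₁, κ̃+e₁+e₂-e₃, κ̃+2e₁-e₂, κ̃+2e₁-e₃` -/
noncomputable def d5aK (κt : Fin 4 →₀ ℕ) : Fin 6 → (Fin 4 →₀ ℕ) :=
  ![κt + Finsupp.single 2 1, gshift (κt + Finsupp.single 2 1) 2 3, κt + Finsupp.single 1 1, gshift (κt + Finsupp.single 1 1) 2 3,
    gshift (κt + Finsupp.single 1 1) 1 2, gshift (κt + Finsupp.single 1 1) 1 3]

/-- **D5 numerator identity, case `κ₀ ≥ 1`**: `H = q·g^{κ̃+e₀}`, `Q = -(q/g)·g^{κ̃}`. -/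
theorem d5a_numer {t : Fin 3 → ℝ} (ht : t ∈ KZ.openOrderedSimplex 3) (κt : Fin 4 →₀ ℕ) (q : ℚ) (g a : ℕ) (hg : 1 ≤ g) :
    aeval (gaps t) (gRc2Q (monomial (κt + Finsupp.single 0 1) q) (monomial κt (-(q / g))) g a) =
      ∑ j : Fin 6, (d5aC κt q g a j : ℝ) * gmon (d5aK κt j) t := by
  obtain ⟨h0, h1, h1', h2', hδ⟩ := simplex3_facts ht
  have g0 := gaps_ne_zero ht 0
  have g1 := gaps_ne_zero ht 1
  have g2 := gaps_ne_zero ht 2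
  have g3 := gaps_ne_zero ht 3
  simp only [gaps_zero, gaps_one, gaps_two, gaps_three] at g0 g1 g2 g3
  have hgR : (g : ℝ) ≠ 0 := by exact_mod_cast (by omega : g ≠ 0)
  have k2 : (κt + Finsupp.single (0 : Fin 4) 1 : Fin 4 →₀ ℕ) 2 = κt 2 := by simp
  have k3 : (κt + Finsupp.single (0 : Fin 4) 1 : Fin 4 →₀ ℕ) 3 = κt 3 := by simp
  have s3 : ((2 : Fin 3).succ : Fin 4) = 3 := rfl
  have s2 : ((2 : Fin 3).castSucc : Fin 4) = 2 := rfl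
  set e : ℚ := -(q / g) with he
  rw [Fin.sum_univ_six]
  simp only [d5aC, d5aK, Matrix.cons_val_zero, Matrix.cons_val_one, Matrix.head_cons, Matrix.cons_val_two, Matrix.tail_cons,
    Matrix.cons_val_three, Matrix.cons_val_four, Matrix.cons_val]
  rw [smul_gmon_gshift ht _ (κt + Finsupp.single 2 1) 2 3 (by decide) (κt 3) (by simp),
    smul_gmon_gshift ht _ (κt + Finsupp.single 1 1) 2 3 (by decide) (κt 3) (by simp),
    smul_gmon_gshift ht _ (κt + Finsupp.single 1 1) 1 2 (by decide) (κt 2) (by simp),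
    smul_gmon_gshift ht _ (κt + Finsupp.single 1 1) 1 3 (by decide) (κt 3) (by simp)]
  rw [gRc2Q]
  simp only [map_sub, map_neg, map_mul, map_add, gD_mul, gD_two_fC2, map_one, aeval_gaps_gD_monomial ht, aeval_gaps_monomial,
    MvPolynomial.aeval_C, map_natCast, eq_ratCast, aeval_gaps_fC2, aeval_gaps_fAl, gmon_add_single, k2, k3, s3, s2, gaps_zero, gaps_one,
    gaps_two, gaps_three]
  rw [he]
  push_cast
  field_simp
  ring

/-- D5, case `κ₀ = 0` (numerator homogenised by `SIG`): the four coefficients … -/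
noncomputable def d5bC (κ : Fin 4 →₀ ℕ) (q : ℚ) (g a : ℕ) : Fin 4 → ℚ :=
  ![q * ((κ 2 : ℕ) - (a : ℚ)) / g, q * ((g : ℚ) - 1 - (κ 3 : ℕ)) / g, q / g * (κ 2 : ℕ), q * ((g : ℚ) - 1 - (κ 3 : ℕ)) / g]

/-- … and the four exponent vectors `κ+e₃, κ+e₂, κ+e₁+e₃-e₂, κ+e₁` -/
noncomputable def d5bK (κ : Fin 4 →₀ ℕ) : Fin 4 → (Fin 4 →₀ ℕ) :=
  ![κ + Finsupp.single 3 1, κ + Finsupp.single 2 1, gshift (κ + Finsupp.single 3 1) 1 2, κ + Finsupp.single 1 1]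

/-- **D5 numerator identity, case `κ₀ = 0`**: `H = q·g^κ·SIG`, `Q = -(q/g)·g^κ`. -/
theorem d5b_numer {t : Fin 3 → ℝ} (ht : t ∈ KZ.openOrderedSimplex 3) (κ : Fin 4 →₀ ℕ) (q : ℚ) (g a : ℕ) (hg : 1 ≤ g) :
    aeval (gaps t) (gRc2Q (monomial κ q * gsum) (monomial κ (-(q / g))) g a) =
      ∑ j : Fin 4, (d5bC κ q g a j : ℝ) * gmon (d5bK κ j) t := by
  obtain ⟨h0, h1, h1', h2', hδ⟩ := simplex3_facts ht
  have g0 := gaps_ne_zero ht 0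
  have g1 := gaps_ne_zero ht 1
  have g2 := gaps_ne_zero ht 2
  have g3 := gaps_ne_zero ht 3
  simp only [gaps_zero, gaps_one, gaps_two, gaps_three] at g0 g1 g2 g3
  have hgR : (g : ℝ) ≠ 0 := by exact_mod_cast (by omega : g ≠ 0)
  have s3 : ((2 : Fin 3).succ : Fin 4) = 3 := rfl
  have s2 : ((2 : Fin 3).castSucc : Fin 4) = 2 := rfl
  set e : ℚ := -(q / g) with he
  rw [Fin.sum_univ_four]
  simp only [d5bC, d5bK, Matrix.cons_val_zero, Matrix.cons_val_one, Matrix.head_cons, Matrix.cons_val_two, Matrix.tail_cons,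
    Matrix.cons_val_three]
  rw [smul_gmon_gshift ht _ (κ + Finsupp.single 3 1) 1 2 (by decide) (κ 2) (by simp)]
  rw [gRc2Q]
  simp only [map_sub, map_neg, map_mul, map_add, gD_mul, gD_gsum, gD_two_fC2, map_one, mul_zero, add_zero,
    aeval_gaps_gD_monomial ht, aeval_gaps_monomial, aeval_gaps_gsum, mul_one, MvPolynomial.aeval_C, map_natCast, eq_ratCast,
    aeval_gaps_fC2, aeval_gaps_fAl, gmon_add_single, s3, s2, gaps_one, gaps_two, gaps_three]
  rw [he]
  push_cast
  field_simp
  ring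

/-- D3, case `κ₃ ≥ 1` (`κ = κ̃ + e₃`, `γ₁ = 0`): the four coefficients … -/
noncomputable def d3aC (κt : Fin 4 →₀ ℕ) (q : ℚ) (b : ℕ) : Fin 4 → ℚ :=
  ![q * ((b : ℚ) - 1 - (κt 2 : ℕ)) / b, q * ((b : ℚ) - 1 - (κt 2 : ℕ)) / b, q / b * (κt 1 : ℕ), q / b * (κt 1 : ℕ)]

/-- … and the four exponent vectors `κ̃+e₀, κ̃+e₁, κ̃+e₀+e₂-e₁, κ̃+e₂` -/
noncomputable def d3aK (κt : Fin 4 →₀ ℕ) : Fin 4 → (Fin 4 →₀ ℕ) :=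
  ![κt + Finsupp.single 0 1, κt + Finsupp.single 1 1, gshift (κt + Finsupp.single 0 1) 2 1, κt + Finsupp.single 2 1]

/-- **D3 numerator identity, case `κ₃ ≥ 1`**: `H = q·g^{κ̃+e₃}`, `Q = (q/b)·g^{κ̃}`, `γ₁ = 0`. -/
theorem d3a_numer {t : Fin 3 → ℝ} (ht : t ∈ KZ.openOrderedSimplex 3) (κt : Fin 4 →₀ ℕ) (q : ℚ) (b : ℕ) (hb : 1 ≤ b) :
    aeval (gaps t) (gR1Q (monomial (κt + Finsupp.single 3 1) q) (monomial κt (q / b)) b 0) =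
      ∑ j : Fin 4, (d3aC κt q b j : ℝ) * gmon (d3aK κt j) t := by
  obtain ⟨h0, h1, h1', h2', hδ⟩ := simplex3_facts ht
  have g0 := gaps_ne_zero ht 0
  have g1 := gaps_ne_zero ht 1
  have g2 := gaps_ne_zero ht 2
  have g3 := gaps_ne_zero ht 3
  simp only [gaps_zero, gaps_one, gaps_two, gaps_three] at g0 g1 g2 g3
  have hbR : (b : ℝ) ≠ 0 := by exact_mod_cast (by omega : b ≠ 0)
  have k1 : (κt + Finsupp.single (3 : Fin 4) 1 : Fin 4 →₀ ℕ) 1 = κt 1 := by simp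
  have k2 : (κt + Finsupp.single (3 : Fin 4) 1 : Fin 4 →₀ ℕ) 2 = κt 2 := by simp
  have s2 : ((1 : Fin 3).succ : Fin 4) = 2 := rfl
  have s1 : ((1 : Fin 3).castSucc : Fin 4) = 1 := rfl
  set e : ℚ := q / b with he
  rw [Fin.sum_univ_four]
  simp only [d3aC, d3aK, Matrix.cons_val_zero, Matrix.cons_val_one, Matrix.head_cons, Matrix.cons_val_two, Matrix.tail_cons,
    Matrix.cons_val_three]
  rw [smul_gmon_gshift ht _ (κt + Finsupp.single 0 1) 2 1 (by decide) (κt 1) (by simp)]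
  rw [gR1Q]
  simp only [map_sub, map_mul, map_add, gD_mul, gD_one_fB1, one_mul, aeval_gaps_gD_monomial ht, aeval_gaps_monomial,
    MvPolynomial.aeval_C, map_natCast, eq_ratCast, aeval_gaps_fC1, aeval_gaps_fB1, gmon_add_single, k1, k2, s2, s1, gaps_zero, gaps_one,
    gaps_two, gaps_three]
  rw [he]
  push_cast
  field_simp
  ring

/-- D3, case `κ₃ = 0` (numerator homogenised by `SIG`, `γ₁ = 0`): the six coefficients … -/
noncomputable def d3bC (κ : Fin 4 →₀ ℕ) (q : ℚ) (b : ℕ) : Fin 6 → ℚ :=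
  ![q / b * (κ 2 : ℕ), 2 * q / b * (κ 2 : ℕ), q / b * (κ 2 : ℕ), -(q / b) * (κ 1 : ℕ), q * ((b : ℚ) - 1 - 2 * (κ 1 : ℕ)) / b,
    q * ((b : ℚ) - 1 - (κ 1 : ℕ)) / b]

/-- … and the six exponent vectors `κ+2e₀-e₂, κ+e₀+e₁-e₂, κ+2e₁-e₂, κ+2e₀-e₁, κ+e₀, κ+e₁` -/
noncomputable def d3bK (κ : Fin 4 →₀ ℕ) : Fin 6 → (Fin 4 →₀ ℕ) :=
  ![gshift (κ + Finsupp.single 0 1) 0 2, gshift (κ + Finsupp.single 0 1) 1 2, gshift (κ + Finsupp.single 1 1) 1 2,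
    gshift (κ + Finsupp.single 0 1) 0 1, κ + Finsupp.single 0 1, κ + Finsupp.single 1 1]

/-- **D3 numerator identity, case `κ₃ = 0`**: `H = q·g^κ·SIG`, `Q = (q/b)·g^κ`, `γ₁ = 0`. -/
theorem d3b_numer {t : Fin 3 → ℝ} (ht : t ∈ KZ.openOrderedSimplex 3) (κ : Fin 4 →₀ ℕ) (q : ℚ) (b : ℕ) (hb : 1 ≤ b) :
    aeval (gaps t) (gR1Q (monomial κ q * gsum) (monomial κ (q / b)) b 0) =
      ∑ j : Fin 6, (d3bC κ q b j : ℝ) * gmon (d3bK κ j) t := by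
  obtain ⟨h0, h1, h1', h2', hδ⟩ := simplex3_facts ht
  have g0 := gaps_ne_zero ht 0
  have g1 := gaps_ne_zero ht 1
  have g2 := gaps_ne_zero ht 2
  have g3 := gaps_ne_zero ht 3
  simp only [gaps_zero, gaps_one, gaps_two, gaps_three] at g0 g1 g2 g3
  have hbR : (b : ℝ) ≠ 0 := by exact_mod_cast (by omega : b ≠ 0)
  have s2 : ((1 : Fin 3).succ : Fin 4) = 2 := rfl
  have s1 : ((1 : Fin 3).castSucc : Fin 4) = 1 := rfl
  set e : ℚ := q / b with he
  rw [Fin.sum_univ_six]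
  simp only [d3bC, d3bK, Matrix.cons_val_zero, Matrix.cons_val_one, Matrix.head_cons, Matrix.cons_val_two, Matrix.tail_cons,
    Matrix.cons_val_three, Matrix.cons_val_four, Matrix.cons_val]
  rw [smul_gmon_gshift ht _ (κ + Finsupp.single 0 1) 0 2 (by decide) (κ 2) (by simp),
    smul_gmon_gshift ht _ (κ + Finsupp.single 0 1) 1 2 (by decide) (κ 2) (by simp),
    smul_gmon_gshift ht _ (κ + Finsupp.single 1 1) 1 2 (by decide) (κ 2) (by simp),
    smul_gmon_gshift ht _ (κ + Finsupp.single 0 1) 0 1 (by decide) (κ 1) (by simp)]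
  rw [gR1Q]
  simp only [map_sub, map_mul, map_add, gD_mul, gD_gsum, gD_one_fB1, one_mul, mul_zero, add_zero,
    aeval_gaps_gD_monomial ht, aeval_gaps_monomial, aeval_gaps_gsum, mul_one, MvPolynomial.aeval_C, map_natCast, eq_ratCast,
    aeval_gaps_fC1, aeval_gaps_fB1, gmon_add_single, s2, s1, gaps_zero, gaps_one, gaps_two]
  rw [he]
  push_cast
  field_simp
  ring

end ShortQ

end Summit.KontsevichZagierPeriods.RootDecompZetaThreeFrontier.WordLayer
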